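import Literature.RepresentationTheory.HeisenbergGroup.MpPsiIntertwinerCongr
import Literature.RepresentationTheory.HeisenbergGroup.SchrodingerModel
import HarnessLib

/-!
# Rescaling the additive character: the `ψ(a·)`-Schrödinger model of `β` IS the `ψ`-Schrödinger model of `a • β`

Topic `RepresentationTheory/HeisenbergGroup`; namespace `Literature.RepresentationTheory.HeisenbergGroup`.  KERNEL ONLY:
definitions with bodies + theorems; no record, no named fact, no `sorry`.  Companion of `SchrodingerConjugate(Gram)`
(the OPPOSITE pairing `-β` ↔ complex conjugation) for a UNIT rescaling `a • β`, `a ∈ Rˣ`: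

For a bilinear `B` on `V` and a unit `a`, the **centre rescaling** `(w, t) ↦ (w, a t)` is an isomorphism
`Heisenberg B ≃* Heisenberg (a B)` (`Heisenberg.centerRescale`, §1); the alternating forms of `polar β` and
`polar (a • β)` have the same isometries (`mem_symplecticGroup_smul_iff`, `symplecticGroupSmulEquiv` — the identity on the
underlying automorphisms of `W = X × Y`), and Weil's sections correspond (`ofSymplectic_act_centerRescale`: the second-degree
character `½ (B(gw)(gw) − B w w)` scales by `a`).  On the model side (§2), for a character `ψ` of `R` and its rescaling
`ψ.mulShift a = ψ(a ·)` (Mathlib `AddChar.mulShift`), the Schrödinger operators agree ON THE NOSE on `X → ℂ` and on `𝒮(X)`: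
`ρ_{β, ψ(a·)}(h) = ρ_{a•β, ψ}(centerRescale h)` (`schrodinger_mulShift`, `schrodingerSB_mulShift`:
`ψ(a (t + β u y)) = ψ(a t + (aβ) u y)`).  Hence (§3) MVW's groups of pairs are isomorphic OVER THE IDENTITY of `Sp(W)`:
**`MpPsi.addCharRescale : S̃p_{ψ(a·)}(W_β) ≃* S̃p_ψ(W_{a•β})`**, `(g, M) ↦ (g, M)` (the instance `T = 1` of the tree's transport
`MpPsi.congr`), with `proj`/`toRep` unchanged (`coe_proj_addCharRescale`, `toRep_addCharRescale_apply`), scalars to scalars, and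
for a homomorphism `s : G →* S̃p_{ψ(a·)}(W_β)` the transported section `addCharRescale ∘ s` has the SAME underlying
symplectic elements and the SAME Weil representation (`toRep_comp_addCharRescale_comp`, an equality of representations of `G` on
`𝒮(X)` — smoothness, coinvariants and isomorphism classes transfer by rewriting).

[MoeglinVignerasWaldspurger1987, Chap. 2 II Remarque (2)]: «les groupes symplectiques de `W` muni de `⟨,⟩` et de `W` muni de
`a⟨,⟩` sont égaux» and the metaplectic representation for `(a⟨,⟩, ψ)` is that of `(⟨,⟩, ψ_a)`, `ψ_a(x) = ψ(ax)`;
[Weil1964, n° 5 (5)–(6)] for the automorphisms of `A(G)`.  Use (cell `hodgecm-mathlib`, row III-11 road, piece P4 «`ψ_v(κ·)` ↔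
line scaling `⟨t a⟩`», lead B-p14): the step `S̃p_{ψ_v(t·)}(𝕎_T) ≅ S̃p_{ψ_v}(𝕎_{tT})` of the Aut(ℂ)-twist calculus of the local
oscillator representation; nothing about unitary groups is used here.  HC_CM is NOT proved in this file.

## References
* [MoeglinVignerasWaldspurger1987] C. Mœglin, M.-F. Vignéras, J.-L. Waldspurger, LNM 1291 (1987), Chap. 2 I.4 Exemple (1),
  II.1 (A)–(B), II Remarques (2)–(3).
* [Weil1964] A. Weil, *Sur certains groupes d'opérateurs unitaires*, Acta Math. 111 (1964), n° 5 (5)–(6), pp. 149–151.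
-/

set_option autoImplicit false

noncomputable section

namespace Literature.RepresentationTheory.HeisenbergGroup

open Literature.NumberTheory.Automorphic (SchwartzBruhat)

universe u v w

/-! ## §1 Algebra: the centre rescaling, the symplectic group, Weil's section -/

section Center

variable {R : Type u} [CommRing R] {V : Type v} [AddCommGroup V] [Module R V]
  (B B' : V →ₗ[R] V →ₗ[R] R) (a : Rˣ) (hB : ∀ w w' : V, B' w w' = (a : R) * B w w')

/-- **the centre rescaling `(w, t) ↦ (w, a t)`**, an isomorphism `Heisenberg B ≃* Heisenberg B'` whenever `B' = a B`
pointwise and `a` is a unit (`(v + v', a (t + t' + B v v')) = (v, a t) · (v', a t')` in `Heisenberg (aB)`).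
[cite: Weil1964, n° 5 (5), p. 149] [cite: MoeglinVignerasWaldspurger1987, Chap. 2 II Remarque (2)] -/
def Heisenberg.centerRescale : Heisenberg B ≃* Heisenberg B' where
  toFun h := ⟨h.v, (a : R) * h.t⟩
  invFun h := ⟨h.v, ((a⁻¹ : Rˣ) : R) * h.t⟩
  left_inv h := by
    ext
    · rfl
    · show ((a⁻¹ : Rˣ) : R) * ((a : R) * h.t) = h.t
      rw [← mul_assoc, Units.inv_mul, one_mul]
  right_inv h := by
    ext
    · rfl
    · show (a : R) * (((a⁻¹ : Rˣ) : R) * h.t) = h.t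
      rw [← mul_assoc, Units.mul_inv, one_mul]
  map_mul' h h' := by
    ext
    · rfl
    · show (a : R) * (h.t + h'.t + B h.v h'.v) = (a : R) * h.t + (a : R) * h'.t + B' h.v h'.v
      rw [hB, mul_add, mul_add]

/-- vector component of `centerRescale h`. [cite: Weil1964, n° 5 (5), p. 149] -/
@[simp] theorem Heisenberg.centerRescale_v (h : Heisenberg B) : (Heisenberg.centerRescale B B' a hB h).v = h.v := rfl

/-- central component of `centerRescale h`: `a t`. [cite: Weil1964, n° 5 (5), p. 149] -/
@[simp] theorem Heisenberg.centerRescale_t (h : Heisenberg B) :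
    (Heisenberg.centerRescale B B' a hB h).t = (a : R) * h.t := rfl

/-- vector component of `centerRescale⁻¹ h`. [cite: Weil1964, n° 5 (5), p. 149] -/
@[simp] theorem Heisenberg.centerRescale_symm_v (h : Heisenberg B') :
    ((Heisenberg.centerRescale B B' a hB).symm h).v = h.v := rfl

/-- central component of `centerRescale⁻¹ h`: `a⁻¹ t`. [cite: Weil1964, n° 5 (5), p. 149] -/
@[simp] theorem Heisenberg.centerRescale_symm_t (h : Heisenberg B') :
    ((Heisenberg.centerRescale B B' a hB).symm h).t = ((a⁻¹ : Rˣ) : R) * h.t := rfl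

end Center

section Polar

variable {R : Type u} [CommRing R] {X : Type v} {Y : Type w} [AddCommGroup X] [Module R X] [AddCommGroup Y] [Module R Y]
  (β : X →ₗ[R] Y →ₗ[R] R)

/-- `polar (a • β) = a · polar β` pointwise. [cite: MoeglinVignerasWaldspurger1987, Chap. 2 II Remarque (2)] -/
theorem polar_smul (a : R) (w w' : X × Y) : polar (a • β) w w' = a * polar β w w' := by
  simp only [polar_apply, LinearMap.smul_apply, smul_eq_mul]

/-- the form used by `Heisenberg.centerRescale` between `Heisenberg (polar β)` and `Heisenberg (polar (a • β))`.
[cite: MoeglinVignerasWaldspurger1987, Chap. 2 II Remarque (2)] -/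
theorem polar_smul_units (a : Rˣ) (w w' : X × Y) : polar ((a : R) • β) w w' = (a : R) * polar β w w' :=
  polar_smul β (a : R) w w'

/-- **the symplectic groups of `polar β` and `polar (a • β)` have the same elements** for a unit `a` («les groupes
symplectiques de `W` muni de `⟨,⟩` et de `a⟨,⟩` sont égaux»). [cite: MoeglinVignerasWaldspurger1987, Chap. 2 II Remarque (2)] -/
theorem mem_symplecticGroup_smul_iff (a : Rˣ) (g : (X × Y) ≃ₗ[R] (X × Y)) :
    g ∈ symplecticGroup (polar ((a : R) • β)) ↔ g ∈ symplecticGroup (polar β) := by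
  simp only [mem_symplecticGroup, polar_apply, LinearMap.smul_apply, smul_eq_mul]
  constructor
  · intro h w w'
    have := congrArg (fun r : R => ((a⁻¹ : Rˣ) : R) * r) (h w w')
    simp only [mul_sub, ← mul_assoc, Units.inv_mul, one_mul] at this
    exact this
  · intro h w w'
    rw [← mul_sub, ← mul_sub, h w w']

/-- **`Sp(polar β) ≃* Sp(polar (a • β))`**, the identity on underlying linear automorphisms of `X × Y`.
[cite: MoeglinVignerasWaldspurger1987, Chap. 2 II Remarque (2)] -/
def symplecticGroupSmulEquiv (a : Rˣ) : symplecticGroup (polar β) ≃* symplecticGroup (polar ((a : R) • β)) where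
  toFun g := ⟨g.1, (mem_symplecticGroup_smul_iff β a g.1).2 g.2⟩
  invFun g := ⟨g.1, (mem_symplecticGroup_smul_iff β a g.1).1 g.2⟩
  left_inv _ := rfl
  right_inv _ := rfl
  map_mul' _ _ := rfl

/-- underlying map of `symplecticGroupSmulEquiv a g`. [cite: MoeglinVignerasWaldspurger1987, Chap. 2 II Remarque (2)] -/
@[simp] theorem symplecticGroupSmulEquiv_coe (a : Rˣ) (g : symplecticGroup (polar β)) :
    ((symplecticGroupSmulEquiv β a g : symplecticGroup (polar ((a : R) • β))) : (X × Y) ≃ₗ[R] (X × Y)) = g.1 := rfl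

/-- underlying map of `(symplecticGroupSmulEquiv a)⁻¹ g`. [cite: MoeglinVignerasWaldspurger1987, Chap. 2 II Remarque (2)] -/
@[simp] theorem symplecticGroupSmulEquiv_symm_coe (a : Rˣ) (g : symplecticGroup (polar ((a : R) • β))) :
    (((symplecticGroupSmulEquiv β a).symm g : symplecticGroup (polar β)) : (X × Y) ≃ₗ[R] (X × Y)) = g.1 := rfl

/-- **Weil's sections correspond under the centre rescaling**: `centerRescale ((ofSymplectic (polar β) g)·h) =
(ofSymplectic (polar (a•β)) g)·(centerRescale h)` — the linear parts agree and the second-degree character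
`½ (B(gw)(gw) − B w w)` of `a • β` is `a` times that of `β`. [cite: Weil1964, n° 5 (5)–(6), pp. 149–151] -/
theorem ofSymplectic_act_centerRescale [Invertible (2 : R)] (a : Rˣ) (g : symplecticGroup (polar β))
    (h : Heisenberg (polar β)) :
    Heisenberg.centerRescale (polar β) (polar ((a : R) • β)) a (polar_smul_units β a) ((ofSymplectic (polar β) g).act h) =
      (ofSymplectic (polar ((a : R) • β)) (symplecticGroupSmulEquiv β a g)).act
        (Heisenberg.centerRescale (polar β) (polar ((a : R) • β)) a (polar_smul_units β a) h) := by
  refine Heisenberg.ext rfl ?_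
  rw [Heisenberg.centerRescale_t, Heisenberg.PseudoSymplectic.act_t, Heisenberg.PseudoSymplectic.act_t, ofSymplectic_f,
    ofSymplectic_f, Heisenberg.centerRescale_t, Heisenberg.centerRescale_v, symplecticGroupSmulEquiv_coe, polar_smul_units,
    polar_smul_units]
  ring

end Polar

/-! ## §2 The Schrödinger operators: `ρ_{β, ψ(a·)}(h) = ρ_{a•β, ψ}(centerRescale h)` -/

section Model

variable {R : Type u} [CommRing R] {X : Type v} {Y : Type w} [AddCommGroup X] [Module R X] [AddCommGroup Y] [Module R Y]
  (β : X →ₗ[R] Y →ₗ[R] R) (ψ : AddChar R Circle) (a : Rˣ)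

/-- **the `ψ(a·)`-Schrödinger operator of `h` for `β` is the `ψ`-Schrödinger operator of `centerRescale h` for `a • β`**
(on all functions `X → ℂ`): `ψ(a (t + β u y)) f(u + x) = ψ(a t + (aβ) u y) f(u + x)`.
[cite: MoeglinVignerasWaldspurger1987, Chap. 2 I.4 Exemple (1) and II Remarque (2)] -/
theorem schrodinger_mulShift (h : Heisenberg (polar β)) (f : X → ℂ) :
    schrodinger β (ψ.mulShift (a : R)) h f =
      schrodinger ((a : R) • β) ψ (Heisenberg.centerRescale (polar β) (polar ((a : R) • β)) a (polar_smul_units β a) h) f := by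
  funext u
  rw [schrodinger_apply, schrodinger_apply, AddChar.mulShift_apply, Heisenberg.centerRescale_t, Heisenberg.centerRescale_v,
    LinearMap.smul_apply, LinearMap.smul_apply, smul_eq_mul, mul_add]

variable [TopologicalSpace X] [TopologicalSpace R]

/-- `ψ(a·)` is locally constant when `ψ` is (multiplication by `a` is continuous). [cite: MoeglinVignerasWaldspurger1987, Chap. 2 I.2] -/
theorem isLocallyConstant_mulShift [ContinuousMul R] (hl : IsLocallyConstant (⇑ψ : R → Circle)) (r : R) :
    IsLocallyConstant (⇑(ψ.mulShift r) : R → Circle) := by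
  have e : (⇑(ψ.mulShift r) : R → Circle) = (⇑ψ : R → Circle) ∘ fun x => r * x := by
    funext x; exact AddChar.mulShift_apply
  rw [e]
  exact hl.comp_continuous (continuous_const.mul continuous_id)

/-- `(a • β)(·, y)` is continuous when `β(·, y)` is. [cite: MoeglinVignerasWaldspurger1987, Chap. 2 I.4 Exemple (1)] -/
theorem continuous_smul_pairing_left [ContinuousMul R] (hb : ∀ y : Y, Continuous fun u : X => β u y) (r : R) (y : Y) :
    Continuous fun u : X => (r • β) u y := by
  have e : (fun u : X => (r • β) u y) = fun u => r * β u y := by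
    funext u; rw [LinearMap.smul_apply, LinearMap.smul_apply, smul_eq_mul]
  rw [e]
  exact continuous_const.mul (hb y)

variable [IsTopologicalAddGroup X]
  (hl : IsLocallyConstant (⇑ψ : R → Circle)) (hla : IsLocallyConstant (⇑(ψ.mulShift (a : R)) : R → Circle))
  (hb : ∀ y : Y, Continuous fun u : X => β u y) (hba : ∀ y : Y, Continuous fun u : X => ((a : R) • β) u y)

/-- **the same on the Schwartz–Bruhat model**: `ρ_{β, ψ(a·)}(h) f = ρ_{a•β, ψ}(centerRescale h) f` in `𝒮(X)`.
[cite: MoeglinVignerasWaldspurger1987, Chap. 2 I.4 Exemple (1) and II Remarque (2)] -/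
theorem schrodingerSB_mulShift (h : Heisenberg (polar β)) (f : SchwartzBruhat X) :
    schrodingerSB β (ψ.mulShift (a : R)) hla hb h f =
      schrodingerSB ((a : R) • β) ψ hl hba
        (Heisenberg.centerRescale (polar β) (polar ((a : R) • β)) a (polar_smul_units β a) h) f :=
  Subtype.ext (by rw [coe_schrodingerSB, coe_schrodingerSB, schrodinger_mulShift])

/-- the intertwining hypothesis of `MpPsi.congr` for `T = 1`. [cite: MoeglinVignerasWaldspurger1987, Chap. 2 I.7] -/
theorem addCharRescale_intertwines (h : Heisenberg (polar β)) (f : SchwartzBruhat X) :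
    (LinearEquiv.refl ℂ (SchwartzBruhat X)) (schrodingerSB β (ψ.mulShift (a : R)) hla hb h f) =
      schrodingerSB ((a : R) • β) ψ hl hba
        (Heisenberg.centerRescale (polar β) (polar ((a : R) • β)) a (polar_smul_units β a) h)
        ((LinearEquiv.refl ℂ (SchwartzBruhat X)) f) :=
  schrodingerSB_mulShift β ψ a hl hla hb hba h f

omit [TopologicalSpace X] [TopologicalSpace R] [IsTopologicalAddGroup X] in
/-- the section-compatibility hypothesis of `MpPsi.congr` (Weil's sections, §1). [cite: Weil1964, n° 5 (5)–(6), pp. 149–151] -/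
theorem addCharRescale_sections [Invertible (2 : R)] (g : symplecticGroup (polar β)) (h : Heisenberg (polar β)) :
    Heisenberg.centerRescale (polar β) (polar ((a : R) • β)) a (polar_smul_units β a) ((ofSymplectic (polar β) g).act h) =
      (ofSymplectic (polar ((a : R) • β)) (symplecticGroupSmulEquiv β a g)).act
        (Heisenberg.centerRescale (polar β) (polar ((a : R) • β)) a (polar_smul_units β a) h) :=
  ofSymplectic_act_centerRescale β a g h

/-! ## §3 `S̃p_{ψ(a·)}(W_β) ≃* S̃p_ψ(W_{a•β})` over the identity of `Sp(W)` -/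

variable [Invertible (2 : R)]

/-- **`S̃p_{ψ(a·)}(W_β) ≃* S̃p_ψ(W_{a•β})`, `(g, M) ↦ (g, M)`**: MVW's groups of pairs of the `ψ(a·)`-Schrödinger model of `β` and of
the `ψ`-Schrödinger model of `a • β` are isomorphic over the identity of the symplectic group, with the identity as
intertwiner (`MpPsi.congr` at `T = 1`, `Φ = centerRescale`, `φ = symplecticGroupSmulEquiv`).
[cite: MoeglinVignerasWaldspurger1987, Chap. 2 II Remarques (2)–(3)] -/
def MpPsi.addCharRescale :
    MpPsi (schrodingerSB β (ψ.mulShift (a : R)) hla hb) ≃* MpPsi (schrodingerSB ((a : R) • β) ψ hl hba) :=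
  MpPsi.congr (schrodingerSB β (ψ.mulShift (a : R)) hla hb) (schrodingerSB ((a : R) • β) ψ hl hba)
    (addCharRescale_intertwines β ψ a hl hla hb hba) (addCharRescale_sections β a)

/-- underlying pair of `addCharRescale p`: `(g, 1⁻¹ M 1)`. [cite: MoeglinVignerasWaldspurger1987, Chap. 2 II Remarque (3)] -/
theorem MpPsi.coe_addCharRescale (p : MpPsi (schrodingerSB β (ψ.mulShift (a : R)) hla hb)) :
    ((MpPsi.addCharRescale β ψ a hl hla hb hba p : MpPsi (schrodingerSB ((a : R) • β) ψ hl hba)) :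
        symplecticGroup (polar ((a : R) • β)) × (SchwartzBruhat X ≃ₗ[ℂ] SchwartzBruhat X)) =
      (symplecticGroupSmulEquiv β a (p : symplecticGroup (polar β) × (SchwartzBruhat X ≃ₗ[ℂ] SchwartzBruhat X)).1,
        (LinearEquiv.refl ℂ (SchwartzBruhat X)).symm ≪≫ₗ
          (p : symplecticGroup (polar β) × (SchwartzBruhat X ≃ₗ[ℂ] SchwartzBruhat X)).2 ≪≫ₗ
            LinearEquiv.refl ℂ (SchwartzBruhat X)) :=
  rfl

/-- **`addCharRescale` lies over `symplecticGroupSmulEquiv`**. [cite: MoeglinVignerasWaldspurger1987, Chap. 2 II.1 (B)] -/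
@[simp] theorem MpPsi.proj_addCharRescale (p : MpPsi (schrodingerSB β (ψ.mulShift (a : R)) hla hb)) :
    MpPsi.proj _ (MpPsi.addCharRescale β ψ a hl hla hb hba p) = symplecticGroupSmulEquiv β a (MpPsi.proj _ p) :=
  rfl

/-- **… i.e. over the IDENTITY on underlying automorphisms of `W`**. [cite: MoeglinVignerasWaldspurger1987, Chap. 2 II Remarque (2)] -/
@[simp] theorem MpPsi.coe_proj_addCharRescale (p : MpPsi (schrodingerSB β (ψ.mulShift (a : R)) hla hb)) :
    ((MpPsi.proj _ (MpPsi.addCharRescale β ψ a hl hla hb hba p) : symplecticGroup (polar ((a : R) • β))) :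
        (X × Y) ≃ₗ[R] (X × Y)) =
      (MpPsi.proj _ p : symplecticGroup (polar β)) :=
  rfl

/-- **the operator component is unchanged**: `toOp (addCharRescale p) f = toOp p f`. [cite: MoeglinVignerasWaldspurger1987, Chap. 2 II.1 (A)] -/
@[simp] theorem MpPsi.toOp_addCharRescale_apply (p : MpPsi (schrodingerSB β (ψ.mulShift (a : R)) hla hb)) (f : SchwartzBruhat X) :
    MpPsi.toOp _ (MpPsi.addCharRescale β ψ a hl hla hb hba p) f = MpPsi.toOp _ p f :=
  rfl

/-- the operator component as a linear automorphism: `toOp (addCharRescale p) = toOp p`. [cite: MoeglinVignerasWaldspurger1987, Chap. 2 II.1 (A)] -/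
theorem MpPsi.toOp_addCharRescale (p : MpPsi (schrodingerSB β (ψ.mulShift (a : R)) hla hb)) :
    MpPsi.toOp _ (MpPsi.addCharRescale β ψ a hl hla hb hba p) = MpPsi.toOp _ p :=
  LinearEquiv.ext fun _ => rfl

/-- **the Weil representations agree**: `ω_{a•β, ψ}(addCharRescale p) f = ω_{β, ψ(a·)}(p) f`.
[cite: MoeglinVignerasWaldspurger1987, Chap. 2 I.7 and II Remarque (2)] -/
@[simp] theorem MpPsi.toRep_addCharRescale_apply (p : MpPsi (schrodingerSB β (ψ.mulShift (a : R)) hla hb)) (f : SchwartzBruhat X) :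
    MpPsi.toRep (schrodingerSB ((a : R) • β) ψ hl hba) (MpPsi.addCharRescale β ψ a hl hla hb hba p) f =
      MpPsi.toRep (schrodingerSB β (ψ.mulShift (a : R)) hla hb) p f :=
  MpPsi.toRep_congr_apply _ _ (addCharRescale_intertwines β ψ a hl hla hb hba) (addCharRescale_sections β a) p f

/-- **scalars go to scalars**. [cite: MoeglinVignerasWaldspurger1987, Chap. 2 II.1 (B)] -/
@[simp] theorem MpPsi.addCharRescale_ofScalar (c : ℂˣ) :
    MpPsi.addCharRescale β ψ a hl hla hb hba (MpPsi.ofScalar _ c) = MpPsi.ofScalar _ c :=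
  MpPsi.congr_ofScalar _ _ (addCharRescale_intertwines β ψ a hl hla hb hba) (addCharRescale_sections β a) c

/-! ### along a homomorphism `s : G →* S̃p_{ψ(a·)}(W_β)` -/

variable {G : Type*} [Group G] (s : G →* MpPsi (schrodingerSB β (ψ.mulShift (a : R)) hla hb))

/-- **the transported section lies over the same symplectic elements**: `proj (addCharRescale (s g)) = proj (s g)` as
automorphisms of `W`. [cite: MoeglinVignerasWaldspurger1987, Chap. 2 II.1 (B)] -/
theorem MpPsi.coe_proj_addCharRescale_comp (g : G) :
    ((MpPsi.proj _ (((MpPsi.addCharRescale β ψ a hl hla hb hba).toMonoidHom.comp s) g) : symplecticGroup (polar ((a : R) • β))) :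
        (X × Y) ≃ₗ[R] (X × Y)) =
      (MpPsi.proj _ (s g) : symplecticGroup (polar β)) :=
  rfl

/-- the transported section lies over `symplecticGroupSmulEquiv ∘ (proj ∘ s)`. [cite: MoeglinVignerasWaldspurger1987, Chap. 2 II.1 (B)] -/
theorem MpPsi.proj_addCharRescale_comp (g : G) :
    MpPsi.proj _ (((MpPsi.addCharRescale β ψ a hl hla hb hba).toMonoidHom.comp s) g) = symplecticGroupSmulEquiv β a (MpPsi.proj _ (s g)) :=
  rfl

/-- **the Weil representation of the transported section IS that of `s`** (pointwise). [cite: MoeglinVignerasWaldspurger1987, Chap. 2 I.7] -/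
theorem MpPsi.toRep_addCharRescale_comp_apply (g : G) (f : SchwartzBruhat X) :
    ((MpPsi.toRep (schrodingerSB ((a : R) • β) ψ hl hba)).comp ((MpPsi.addCharRescale β ψ a hl hla hb hba).toMonoidHom.comp s)) g f =
      ((MpPsi.toRep (schrodingerSB β (ψ.mulShift (a : R)) hla hb)).comp s) g f :=
  MpPsi.toRep_addCharRescale_apply β ψ a hl hla hb hba (s g) f

/-- **the Weil representation of the transported section IS that of `s`**, as an equality of representations of `G` on `𝒮(X)`
(so smoothness, coinvariants, isomorphism classes transfer by rewriting). [cite: MoeglinVignerasWaldspurger1987, Chap. 2 I.7 and II Remarque (2)] -/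
theorem MpPsi.toRep_comp_addCharRescale_comp :
    (MpPsi.toRep (schrodingerSB ((a : R) • β) ψ hl hba)).comp ((MpPsi.addCharRescale β ψ a hl hla hb hba).toMonoidHom.comp s) =
      (MpPsi.toRep (schrodingerSB β (ψ.mulShift (a : R)) hla hb)).comp s :=
  MonoidHom.ext fun g => LinearMap.ext fun f => MpPsi.toRep_addCharRescale_comp_apply β ψ a hl hla hb hba s g f

/-! ### the `subst`-friendly edition: target pairing `β'` with `β' = a • β` -/

variable {β' : X →ₗ[R] Y →ₗ[R] R} (hβ' : β' = (a : R) • β) (hb' : ∀ y : Y, Continuous fun u : X => β' u y)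

/-- **`S̃p_{ψ(a·)}(W_β) ≃* S̃p_ψ(W_{β'})` for any `β' = a • β`** (the same isomorphism, retyped along `hβ'`).
[cite: MoeglinVignerasWaldspurger1987, Chap. 2 II Remarques (2)–(3)] -/
def MpPsi.addCharRescale' : MpPsi (schrodingerSB β (ψ.mulShift (a : R)) hla hb) ≃* MpPsi (schrodingerSB β' ψ hl hb') := by
  subst hβ'
  exact MpPsi.addCharRescale β ψ a hl hla hb hb'

/-- `addCharRescale'` is `addCharRescale` once `β'` is substituted. [cite: MoeglinVignerasWaldspurger1987, Chap. 2 II Remarque (2)] -/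
theorem MpPsi.addCharRescale'_eq :
    MpPsi.addCharRescale' β ψ a hl hla hb (β' := (a : R) • β) rfl hba = MpPsi.addCharRescale β ψ a hl hla hb hba :=
  rfl

/-- over the identity on automorphisms of `W`, `β'`-edition. [cite: MoeglinVignerasWaldspurger1987, Chap. 2 II Remarque (2)] -/
theorem MpPsi.coe_proj_addCharRescale' (p : MpPsi (schrodingerSB β (ψ.mulShift (a : R)) hla hb)) :
    ((MpPsi.proj _ (MpPsi.addCharRescale' β ψ a hl hla hb hβ' hb' p) : symplecticGroup (polar β')) : (X × Y) ≃ₗ[R] (X × Y)) =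
      (MpPsi.proj _ p : symplecticGroup (polar β)) := by
  subst hβ'
  rfl

/-- the Weil representations agree, `β'`-edition. [cite: MoeglinVignerasWaldspurger1987, Chap. 2 II Remarque (2)] -/
theorem MpPsi.toRep_addCharRescale'_apply (p : MpPsi (schrodingerSB β (ψ.mulShift (a : R)) hla hb)) (f : SchwartzBruhat X) :
    MpPsi.toRep (schrodingerSB β' ψ hl hb') (MpPsi.addCharRescale' β ψ a hl hla hb hβ' hb' p) f =
      MpPsi.toRep (schrodingerSB β (ψ.mulShift (a : R)) hla hb) p f := by
  subst hβ'
  exact MpPsi.toRep_addCharRescale_apply β ψ a hl hla hb hb' p f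

/-- the Weil representation of a transported section, `β'`-edition (equality of representations of `G` on `𝒮(X)`).
[cite: MoeglinVignerasWaldspurger1987, Chap. 2 I.7 and II Remarque (2)] -/
theorem MpPsi.toRep_comp_addCharRescale'_comp :
    (MpPsi.toRep (schrodingerSB β' ψ hl hb')).comp ((MpPsi.addCharRescale' β ψ a hl hla hb hβ' hb').toMonoidHom.comp s) =
      (MpPsi.toRep (schrodingerSB β (ψ.mulShift (a : R)) hla hb)).comp s := by
  subst hβ'
  exact MpPsi.toRep_comp_addCharRescale_comp β ψ a hl hla hb hb' s

/-- the transported section lies over the same automorphisms of `W`, `β'`-edition. [cite: MoeglinVignerasWaldspurger1987, Chap. 2 II.1 (B)] -/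
theorem MpPsi.coe_proj_addCharRescale'_comp (g : G) :
    ((MpPsi.proj _ (((MpPsi.addCharRescale' β ψ a hl hla hb hβ' hb').toMonoidHom.comp s) g) : symplecticGroup (polar β')) :
        (X × Y) ≃ₗ[R] (X × Y)) =
      (MpPsi.proj _ (s g) : symplecticGroup (polar β)) := by
  subst hβ'
  rfl

end Model

end Literature.RepresentationTheory.HeisenbergGroup

end
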